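import Literature.AlgebraicGeometry.HodgeTheory.ComplexBettiKunneth
import Literature.AlgebraicGeometry.HodgeTheory.GysinFormalismCorrespondences
import Literature.AlgebraicGeometry.HodgeTheory.SupportedClassesSemipurity
import HarnessLib

/-!
# Künneth with supports: classes on `(Y ⊗ Z)(ℂ)` dying off `pr_Y⁻¹ S` (resp. `pr_Z⁻¹ S`) are sums of cross products `pr_Y^* a ∪ pr_Z^* b` with `a` (resp. `b`) dying off `S`

Family `hodge`, layer `Literature/AlgebraicGeometry/HodgeTheory`. Companion of `ComplexBettiKunneth`
(`complexBetti_kunneth_bijective`: `H*((Y ⊗ Z)(ℂ); ℂ)` is free over `H*(Y(ℂ); ℂ)` on a basis of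
`H*(Z(ℂ); ℂ)`, Hatcher Thm. 3.16) and of the support filtration `Nᶜ` of `AlgebraicClasses`
(Grothendieck 1969 §1: kernels of the restrictions `H*(X(ℂ)) → H*((X ∖ S)(ℂ))`). The RELATIVE
Künneth formula over a field (Hatcher, *Algebraic Topology*, Thm. 3.18 / 3.21:
`H*(X, A; F) ⊗ H*(Y; F) ≅ H*(X × Y, A × Y; F)`), in the form the coniveau filtration consumes:

* `mem_span_cross_of_restrictCompl_fst_eq_zero` — **for `Y`, `Z` smooth projective over `ℂ` and
  `S ⊆ Y` Zariski-closed, a class `γ ∈ Hᵏ((Y ⊗ Z)(ℂ); ℂ)` vanishing on `((Y ⊗ Z) ∖ pr_Y⁻¹ S)(ℂ)`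
  is a `ℂ`-linear combination of cross products `pr_Y^* a ∪ pr_Z^* b` with `a ∈ Hⁱ(Y(ℂ))`
  VANISHING ON `(Y ∖ S)(ℂ)`** and `b ∈ Hʲ(Z(ℂ))`, `i + j = k`;
* `mem_span_cross_of_restrictCompl_snd_eq_zero` — the same for `S ⊆ Z` and `pr_Z⁻¹ S`, with the
  condition on `b` (transported along the symmetry `Y ⊗ Z ≅ Z ⊗ Y`).

Proof: write `γ = Σⱼ pr_Y^* aⱼ ∪ pr_Z^* eⱼ` on a graded basis `(eⱼ)` of `H*(Z(ℂ))`
(`complexBetti_kunneth_bijective`). Restricted to the open piece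
`W = ((Y ⊗ Z) ∖ pr_Y⁻¹S)(ℂ) ≃ₜ (Y ∖ S)(ℂ) × Z(ℂ)` this reads `0 = Σⱼ q^*(aⱼ|_{(Y∖S)(ℂ)}) ∪ eⱼ|_W`
(naturality of the Leray–Hirsch comparison map, `LerayHirsch.map_lhMap`), and the comparison map
of the product `(Y ∖ S)(ℂ) × Z(ℂ)` over the (paracompact Hausdorff, second countable) open
submanifold `(Y ∖ S)(ℂ)` of `Y(ℂ)` is bijective (`LerayHirsch.bijective_lhMap_fst_prod`, Hatcher
Thm. 3.16 via Leray–Hirsch 4D.1); hence every `aⱼ|_{(Y ∖ S)(ℂ)} = 0`.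

Everything is proved; no named facts, no definitions (the auxiliary homeomorphism is built inside
the proof).

## References

* [HatcherAT2002] A. Hatcher, Algebraic Topology, CUP 2002, §3.2 Thm. 3.16, Thm. 3.18, Thm. 3.21;
  §4.D Thm. 4D.1.
* [GrothendieckTopology1969] A. Grothendieck, Hodge's general conjecture is false for trivial
  reasons, Topology 8 (1969), §1 (the filtration by supports).
* [Fulton1998] W. Fulton, Intersection Theory, 2nd ed. 1998, §19.2 (cohomology with supports and
  exterior products).
-/

noncomputable section

open CategoryTheory AlgebraicGeometry MonoidalCategory CartesianMonoidalCategory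
open Literature.AlgebraicGeometry.Motives
open Literature.AlgebraicTopology.SingularHomology

namespace Literature.AlgebraicGeometry.HodgeTheory

variable {m n : ℕ} {Y Z : SchemeOver ℂ}

/-! ### Künneth with supports along the first factor -/

/-- **Künneth with supports (support pulled back from the first factor).** For `Y`, `Z` smooth
projective over `ℂ`, `S ⊆ Y` Zariski-closed and `γ ∈ Hᵏ((Y ⊗ Z)(ℂ); ℂ)` vanishing on
`((Y ⊗ Z) ∖ pr_Y⁻¹S)(ℂ)`, `γ` is a `ℂ`-linear combination of cross products `pr_Y^* a ∪ pr_Z^* b`,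
`a ∈ Hⁱ(Y(ℂ); ℂ)` vanishing on `(Y ∖ S)(ℂ)`, `b ∈ Hʲ(Z(ℂ); ℂ)`, `i + j = k` (the relative Künneth
formula `H*(Y, Y ∖ S) ⊗ H*(Z) ↠ H*(Y × Z, (Y ∖ S) × Z)` over the field `ℂ`, Hatcher Thm. 3.21, read
through the kernels of restriction). Proof in the module docstring.
[cite: HatcherAT2002, §3.2 Thm. 3.16, Thm. 3.21 and §4.D Thm. 4D.1] [cite: GrothendieckTopology1969, §1] -/
theorem mem_span_cross_of_restrictCompl_fst_eq_zero (hY : IsSmoothProjective m Y)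
    (hZ : IsSmoothProjective n Z) {S : Set Y.left} (hS : IsClosed S) {k : ℕ}
    {γ : complexBetti (Y ⊗ Z) k}
    (hγ : complexBetti.restrictCompl (Y ⊗ Z) ((fst Y Z).left.base ⁻¹' S) k γ = 0) :
    γ ∈ Submodule.span ℂ {v | ∃ (i j : ℕ) (h : i + j = k) (a : complexBetti Y i)
      (b : complexBetti Z j), complexBetti.restrictCompl Y S i a = 0 ∧
        v = cupProduct h (complexBetti.map (fst Y Z) i a) (complexBetti.map (snd Y Z) j b)} := by
  classical
  haveI := fun j ↦ finite_complexBetti hZ j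
  -- a graded basis of `H*(Z(ℂ); ℂ)`
  let c : Fin (2 * n + 1) → ℕ := fun j ↦ Module.finrank ℂ (complexBetti Z j)
  let b : (j : Fin (2 * n + 1)) → Module.Basis (Fin (c j)) ℂ (complexBetti Z j) :=
    fun j ↦ Module.finBasis ℂ (complexBetti Z j)
  let d : (Σ j : Fin (2 * n + 1), Fin (c j)) → ℕ := fun j ↦ (j.1 : ℕ)
  let e : (j : Σ j : Fin (2 * n + 1), Fin (c j)) → complexBetti Z (d j) := fun j ↦ b j.1 j.2
  have he : ∀ k', Function.Bijective (LerayHirsch.lhMap ℂ d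
      (ContinuousMap.const (ComplexPoints Z) PUnit.unit : C(ComplexPoints Z, PUnit.{1})) e k') := by
    refine LerayHirsch.bijective_lhMap_const_of_basis ℂ (fun j i ↦ b j i) (fun j ↦ ?_)
      (fun j hj ↦ subsingleton_complexBetti hZ hj)
    have : (fun r : Fin (c j) → ℂ ↦ ∑ i, r i • b j i) = (b j).equivFun.symm :=
      funext fun r ↦ ((b j).equivFun_symm_apply r).symm
    rw [this]
    exact (b j).equivFun.symm.bijective
  -- (1) the compact Künneth theorem: `γ = Σⱼ pr_Y^* aⱼ ∪ pr_Z^* eⱼ`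
  obtain ⟨a, rfl⟩ := (complexBetti_kunneth_bijective hY hZ b k).2 γ
  -- (2) the open piece and the maps of the restriction square
  let ιW : C(Motives.complexPointsCompl (Y ⊗ Z) ((fst Y Z).left.base ⁻¹' S),
      ComplexPoints (Y ⊗ Z)) := ⟨Subtype.val, continuous_subtype_val⟩
  let ιM : C(Motives.complexPointsCompl Y S, ComplexPoints Y) := ⟨Subtype.val, continuous_subtype_val⟩
  let qW : C(Motives.complexPointsCompl (Y ⊗ Z) ((fst Y Z).left.base ⁻¹' S),
      Motives.complexPointsCompl Y S) := complexPointsComplMap (fst Y Z) S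
  have hsq : (AlgPoints.mapContinuous (L := ℂ) (fst Y Z)).comp ιW = ιM.comp qW := by
    ext P; rfl
  -- naturality of the comparison map under restriction
  have hnat := LerayHirsch.map_lhMap ℂ d (AlgPoints.mapContinuous (L := ℂ) (fst Y Z)) qW ιW ιM hsq
    (fun j ↦ complexBetti.map (snd Y Z) (d j) (e j)) k a
  -- (3) the comparison map of the open piece is one-to-one
  have hbijW : Function.Bijective (LerayHirsch.lhMap ℂ d qW
      (fun j ↦ singularCohomology.map ℂ ℂ ιW (d j) (complexBetti.map (snd Y Z) (d j) (e j))) k) := by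
    -- `(Y ∖ S)(ℂ)` is an open submanifold of the compact manifold `Y(ℂ)`
    letI := hY.chartedSpace
    haveI := ComplexPoints.compactSpace_of_isSmoothProjective hY
    haveI := ComplexPoints.t2Space_of_isSmoothProjective hY
    haveI := IsSmoothProjective.compactSpace_holds hY
    haveI := hY.smoothOfRelativeDimension
    haveI : LocallyOfFiniteType Y.hom := by
      haveI : Smooth Y.hom := SmoothOfRelativeDimension.smooth m _
      infer_instance
    haveI : SecondCountableTopology (ComplexPoints Y) :=
      ComplexPoints.secondCountableTopology_of_compactSpace_holds Y
    let U : TopologicalSpace.Opens (ComplexPoints Y) :=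
      ⟨{P | P.pt ∉ S}, AlgPoints.isOpen_setOf_pt_mem (X := Y) (L := ℂ) ⟨Sᶜ, hS.isOpen_compl⟩⟩
    haveI : ChartedSpace (EuclideanSpace ℝ (Fin (2 * m))) (Motives.complexPointsCompl Y S) :=
      (inferInstance : ChartedSpace (EuclideanSpace ℝ (Fin (2 * m))) U)
    haveI : LocallyCompactSpace (Motives.complexPointsCompl Y S) := U.2.locallyCompactSpace
    haveI : SecondCountableTopology (Motives.complexPointsCompl Y S) :=
      (inferInstance : SecondCountableTopology U)
    haveI : SigmaCompactSpace (Motives.complexPointsCompl Y S) :=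
      sigmaCompactSpace_of_locallyCompact_secondCountable
    haveI : ParacompactSpace (Motives.complexPointsCompl Y S) := inferInstance
    have hprod := LerayHirsch.bijective_lhMap_fst_prod ℂ d e (EuclideanSpace ℝ (Fin (2 * m)))
      (M := Motives.complexPointsCompl Y S) he k
    -- transport along `W = ((Y ⊗ Z) ∖ pr_Y⁻¹S)(ℂ) ≃ₜ (Y ∖ S)(ℂ) × Z(ℂ)` (restriction of
    -- `(Y ⊗ Z)(ℂ) ≃ₜ Y(ℂ) × Z(ℂ)`, `AlgPoints.prodEquiv`, Conrad Prop. 2.1)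
    let Φ : Motives.complexPointsCompl (Y ⊗ Z) ((fst Y Z).left.base ⁻¹' S) ≃ₜ
        Motives.complexPointsCompl Y S × ComplexPoints Z :=
      { toFun := fun P ↦ (⟨(AlgPoints.prodEquiv P.1).1, fun h ↦ P.2 h⟩, (AlgPoints.prodEquiv P.1).2)
        invFun := fun Q ↦ ⟨AlgPoints.prodEquiv.symm (Q.1.1, Q.2), fun h ↦ Q.1.2 (by
          have h' : (AlgPoints.prodEquiv (AlgPoints.prodEquiv.symm (Q.1.1, Q.2))).1.pt ∈ S := h
          rwa [Equiv.apply_symm_apply] at h')⟩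
        left_inv := fun P ↦ Subtype.ext (by
          change AlgPoints.prodEquiv.symm (AlgPoints.prodEquiv P.1) = P.1
          exact Equiv.symm_apply_apply _ _)
        right_inv := fun Q ↦ by
          obtain ⟨⟨Q₁, hQ₁⟩, Q₂⟩ := Q
          have h := Equiv.apply_symm_apply (AlgPoints.prodEquiv (X := Y) (Y := Z) (L := ℂ)) (Q₁, Q₂)
          have h1 : (AlgPoints.prodEquiv (AlgPoints.prodEquiv.symm (Q₁, Q₂))).1 = Q₁ :=
            congrArg Prod.fst h
          have h2 : (AlgPoints.prodEquiv (AlgPoints.prodEquiv.symm (Q₁, Q₂))).2 = Q₂ :=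
            congrArg Prod.snd h
          exact Prod.ext (Subtype.ext h1) h2
        continuous_toFun := by
          have hc : Continuous fun P : Motives.complexPointsCompl (Y ⊗ Z)
              ((fst Y Z).left.base ⁻¹' S) ↦ AlgPoints.prodEquiv (L := ℂ) P.1 :=
            AlgPoints.continuous_prodEquiv.comp continuous_subtype_val
          exact ((continuous_fst.comp hc).subtype_mk _).prodMk (continuous_snd.comp hc)
        continuous_invFun := by
          refine Continuous.subtype_mk ?_ _
          exact AlgPoints.continuous_prodEquiv_symm.comp
            ((continuous_subtype_val.comp continuous_fst).prodMk continuous_snd) }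
    let Φc : C(Motives.complexPointsCompl (Y ⊗ Z) ((fst Y Z).left.base ⁻¹' S),
        Motives.complexPointsCompl Y S × ComplexPoints Z) := Φ
    have hfg : (ContinuousMap.fst : C(Motives.complexPointsCompl Y S × ComplexPoints Z,
        Motives.complexPointsCompl Y S)).comp Φc = (ContinuousMap.id _).comp qW := by
      ext P; rfl
    have h := (LerayHirsch.bijective_lhMap_iff ℂ d _ _ Φc (ContinuousMap.id _) hfg
      (fun j ↦ singularCohomology.map ℂ ℂ (ContinuousMap.snd :
        C(Motives.complexPointsCompl Y S × ComplexPoints Z, ComplexPoints Z)) (d j) (e j))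
      (fun i ↦ (singularCohomology.mapIso ℂ ℂ Φ i).toLinearEquiv.bijective)
      (fun i ↦ (singularCohomology.mapIso ℂ ℂ
        (Homeomorph.refl (Motives.complexPointsCompl Y S)) i).toLinearEquiv.bijective) k).1 hprod
    have hsnd : (ContinuousMap.snd : C(Motives.complexPointsCompl Y S × ComplexPoints Z,
        ComplexPoints Z)).comp Φc = (AlgPoints.mapContinuous (L := ℂ) (snd Y Z)).comp ιW := by
      ext P; rfl
    have hcls : (fun j ↦ singularCohomology.map ℂ ℂ Φc (d j) (singularCohomology.map ℂ ℂ
        (ContinuousMap.snd : C(Motives.complexPointsCompl Y S × ComplexPoints Z, ComplexPoints Z))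
          (d j) (e j))) =
        fun j ↦ singularCohomology.map ℂ ℂ ιW (d j) (complexBetti.map (snd Y Z) (d j) (e j)) := by
      funext j
      rw [← ModuleCat.comp_apply, ← singularCohomology.map_comp, hsnd, singularCohomology.map_comp,
        ModuleCat.comp_apply]
    rwa [hcls] at h
  -- (4) hence every restricted coefficient `aⱼ|_{(Y ∖ S)(ℂ)}` vanishes
  have hzero : (fun j : LerayHirsch.Idx d k ↦ singularCohomology.map ℂ ℂ ιM (k - d j.1) (a j)) = 0 := by
    refine hbijW.1 ?_
    rw [map_zero, ← hnat]
    exact hγ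
  -- (5) conclusion
  rw [LerayHirsch.lhMap_apply]
  refine Submodule.sum_mem _ fun j _ ↦ ?_
  split_ifs with h
  · refine Submodule.subset_span ⟨k - d j, d j, Nat.sub_add_cancel h, a ⟨j, h⟩, e j, ?_, rfl⟩
    exact congrFun hzero ⟨j, h⟩
  · exact Submodule.zero_mem _

/-! ### Künneth with supports along the second factor -/

/-- **Künneth with supports (support pulled back from the second factor).** For `Y`, `Z` smooth
projective over `ℂ`, `S ⊆ Z` Zariski-closed and `γ ∈ Hᵏ((Y ⊗ Z)(ℂ); ℂ)` vanishing on
`((Y ⊗ Z) ∖ pr_Z⁻¹S)(ℂ)`, `γ` is a `ℂ`-linear combination of cross products `pr_Y^* a ∪ pr_Z^* b`,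
`a ∈ Hⁱ(Y(ℂ); ℂ)`, `b ∈ Hʲ(Z(ℂ); ℂ)` vanishing on `(Z ∖ S)(ℂ)`, `i + j = k`
(`mem_span_cross_of_restrictCompl_fst_eq_zero` on `Z ⊗ Y`, transported along the swap
`Y ⊗ Z ≅ Z ⊗ Y`, with graded commutativity of `∪`, Hatcher Thm. 3.11).
[cite: HatcherAT2002, §3.2 Thm. 3.16, Thm. 3.21 and Thm. 3.11] [cite: GrothendieckTopology1969, §1] -/
theorem mem_span_cross_of_restrictCompl_snd_eq_zero (hY : IsSmoothProjective m Y)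
    (hZ : IsSmoothProjective n Z) {S : Set Z.left} (hS : IsClosed S) {k : ℕ}
    {γ : complexBetti (Y ⊗ Z) k}
    (hγ : complexBetti.restrictCompl (Y ⊗ Z) ((snd Y Z).left.base ⁻¹' S) k γ = 0) :
    γ ∈ Submodule.span ℂ {v | ∃ (i j : ℕ) (h : i + j = k) (a : complexBetti Y i)
      (b : complexBetti Z j), complexBetti.restrictCompl Z S j b = 0 ∧
        v = cupProduct h (complexBetti.map (fst Y Z) i a) (complexBetti.map (snd Y Z) j b)} := by
  -- transport `γ` to `Z ⊗ Y`
  set γ' : complexBetti (Z ⊗ Y) k := complexBetti.map (lift (snd Z Y) (fst Z Y)) k γ with hγ'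
  have hpre : (lift (snd Z Y) (fst Z Y)).left.base ⁻¹' ((snd Y Z).left.base ⁻¹' S) =
      (fst Z Y).left.base ⁻¹' S := by
    ext x
    simp only [Set.mem_preimage]
    rw [← Scheme.Hom.comp_apply, ← Over.comp_left, lift_snd]
  have hγ'0 : complexBetti.restrictCompl (Z ⊗ Y) ((fst Z Y).left.base ⁻¹' S) k γ' = 0 := by
    rw [← hpre]
    exact complexBetti.restrictCompl_map_eq_zero (lift (snd Z Y) (fst Z Y)) hγ
  have hmem := mem_span_cross_of_restrictCompl_fst_eq_zero hZ hY hS hγ'0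
  -- and back: `γ = swap^* γ'`
  have hswap : lift (snd Y Z) (fst Y Z) ≫ lift (snd Z Y) (fst Z Y) = 𝟙 _ := by
    ext <;> simp
  have hback : γ = complexBetti.map (lift (snd Y Z) (fst Y Z)) k γ' := by
    rw [hγ', ← ModuleCat.comp_apply, ← complexBetti.map_comp, hswap,
      complexBetti.map_id, ModuleCat.id_apply]
  rw [hback]
  refine Submodule.span_induction (p := fun x _ ↦ complexBetti.map (lift (snd Y Z) (fst Y Z)) k x ∈ _)
    ?_ (by rw [map_zero]; exact Submodule.zero_mem _)
    (fun x y _ _ hx hy ↦ by rw [map_add]; exact Submodule.add_mem _ hx hy)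
    (fun r x _ hx ↦ by rw [map_smul]; exact Submodule.smul_mem _ r hx) hmem
  rintro _ ⟨i, j, h, a, b, ha, rfl⟩
  -- `swap^*(fst^* a ∪ snd^* b) = snd^* a ∪ fst^* b = ± fst^* b ∪ snd^* a`
  have h₁ : complexBetti.map (lift (snd Y Z) (fst Y Z)) i (complexBetti.map (fst Z Y) i a) =
      complexBetti.map (snd Y Z) i a := by
    rw [← ModuleCat.comp_apply, ← complexBetti.map_comp, lift_fst]
  have h₂ : complexBetti.map (lift (snd Y Z) (fst Y Z)) j (complexBetti.map (snd Z Y) j b) =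
      complexBetti.map (fst Y Z) j b := by
    rw [← ModuleCat.comp_apply, ← complexBetti.map_comp, lift_snd]
  rw [complexBetti.map, cupProduct_map, ← complexBetti.map, ← complexBetti.map, h₁, h₂,
    cupProduct_gradedComm_holds ℂ _ h (by omega)]
  refine Submodule.smul_mem _ _ (Submodule.subset_span ⟨j, i, by omega, b, a, ha, rfl⟩)

end Literature.AlgebraicGeometry.HodgeTheory

end
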